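import Summits.QuantumFields.BalabanUV.Beta.GAN24.SubAveragingMinimiserKernel
import Literature.MathematicalPhysics.QuantumFieldTheory.Balaban1983to89.B4TorusKernel

/-!
# `BalabanUV.Beta.GAN24.SubAveragingMinimiserTorus` — binder row G-an2-4 ∕ (CONV-C), programme «SUBAVG-H», FILE F:
# EXPLICIT `d`-ONLY STRIP CONSTANTS FOR THE SCALAR HARD MINIMISER `H_k = 𝒢Q_k^*(Q_k𝒢Q_k^*)⁻¹` (B5 (1.103), massless, `U = 1`), AND THE
# TORUS TWINS — `k`-UNIFORM DECAY AND THE SUB-AVERAGED ONE-STEP RATE `θ = L⁻²` ON EVERY TORUS `Π_μ ℤ∕N_μ`, UNIFORMLY IN THE VOLUME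

NOT IN PRINT; OUR PROOF ATTEMPT (prover part P3 of row G-an2-4, fibre∕strip («Woodbury») lineage, gen 23; CRUX TEAM (2), ruling «YM REDIRECT
TOWARDS THE SUMMIT», 2026-08-21).  HONEST DEPENDENCY (cell records, verbatim): «continuum YM on T⁴ ⇐ BetaPertH ∧ nine spine estimates (0/9
proved); BetaPertH ⇐ (D1) ∧ (D4) ∧ CAP+tail; G-an2-4 gates asym, D1 and NE2/3/4.»  HONEST FRAMING (cell contract, verbatim): «discharging
`BetaPertH` makes Bałaban's UV stability UNCONDITIONAL — a real constructive-QFT result; it is NOT the continuum limit and NOT the Clay problem.»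
ABSOLUTE RULE: nothing printed is a hypothesis.  [folklore] assembly over FILES A∕B (`Hm`, `avgHm`, `DmultH`, `stripRegular_Hm∕avgHm∕DmultH`),
`B4StripCauchy.uniformStrip_explicit` and `FP/CoarseCovarianceSymbol.F_lower` (the two EXPLICIT zero-free strips) and the Poisson-periodisation
engine `B4TorusKernel` (`descendC`, `MultiPeriod.torusKernel`, `torusKernel_descend_decay_torusMetric` — B5 (1.126) on the torus, uniformly in the
period vector).  No `def … : Prop`, no sorry; four [folklore] constant definitions (`kapE`, `kapF`, `kapH`, `cH`, `MH` — all functions of `d` alone).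

## Contents
* §1 `kapE`, `kapF`, **`kapH d = min kapE kapF`**, `cH d = ½(4∕π²)^d` (ONE lower bound serves both denominators), `kapH_pos`, `kapH_le_rOf`,
  **`E_lower_kapH`**, **`F_lower_kapH`**; `MH`; **`stripRegular_Hm_explicit`** (`StripRegular (Hm n τ) (kapH (d+1)) (MH (d+1))`, every `n ≥ 1`, `τ`),
  `stripRegular_avgHm_explicit`, **`stripRegular_DmultH_explicit`** (bound `CH n (d+1) L (cH (d+1)) (cH (d+1))∕n²`).
* §2 the TORUS twins for every period vector `N` (all `N_μ ≥ 1`): **`torusKernel_Hm_decay`** — `‖torusKernel (descendC (Hm n τ) …) N x‖ ≤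
  MH·periodConst·e^{−(kapH∕(d+1))·|x|_{T,∞}}` for every `n ≥ 1`, `τ`, `x` (uniform in `k` AND in the volume); the linearity dictionaries
  `torusKernel_descendC_sub'` ∕ `torusKernel_descendC_avg`; and THE TORUS END **`subavg_minimiser_rate_torus`**: the sub-cell average of the
  finer torus kernels minus the coarser torus kernel is `≤ CH(n)∕n²·periodConst·e^{−(kapH∕(d+1))·|x|_{T,∞}}` — volume-uniform.

HONEST: Poisson periodisation of the infinite-lattice statements of FILE B, nothing more; the torus is where the parked consumers live
(`OneStepAveragedLaw`, the β-function on `T⁴`).  NOT the vector `H_k`, NOT composites, NOT `U ≠ 1`.  NEVER «G-an2-4 closed»; NOT D1, NOT BetaPertH,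
NOT continuum, NOT Clay.  Provenance: prover-b2b-balaban-gan24-p3-g23-0 (unit `b2b-balaban-gan24-p3`, gen 23), 2026-08-21.
-/

noncomputable section

namespace Summit.QuantumFields.BalabanUV.Beta.GAN24.SubAveragingMinimiserTorus

open Complex Finset
open Literature.MathematicalPhysics.QuantumFieldTheory.Balaban1983to89
open Literature.MathematicalPhysics.QuantumFieldTheory.Balaban1983to89.B4Strip
open Literature.MathematicalPhysics.QuantumFieldTheory.Balaban1983to89.B4StripCauchy
open Literature.MathematicalPhysics.QuantumFieldTheory.Balaban1983to89.B4StripSums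
open Literature.MathematicalPhysics.QuantumFieldTheory.Balaban1983to89.B4ContourShift
open Literature.MathematicalPhysics.QuantumFieldTheory.Balaban1983to89.B5Strip145Analytic
open Literature.MathematicalPhysics.QuantumFieldTheory.Balaban1983to89.B4TorusKernel
open Literature.MathematicalPhysics.QuantumFieldTheory.Balaban1983to89.B4TorusKernel.MultiPeriod
  (torusKernel torusSum gridPt torusSupNorm torusKernel_descend_decay_torusMetric)
open Summit.QuantumFields.BalabanUV.Beta.GAN24.SubAveragingKernel
open Summit.QuantumFields.BalabanUV.Beta.GAN24.SubAveragingMinimiser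
open Summit.QuantumFields.BalabanUV.Beta.GAN24.SubAveragingMinimiserKernel
open Summit.QuantumFields.BalabanUV.Beta.FP
open scoped Real

variable {d : ℕ}

/-! ## §1 Explicit `d`-only strip constants and the explicit strip regularity of the hard column -/

/-- [folklore] the explicit half-width of the zero-free strip of B4's soft denominator `E n 1 0` (`B4StripCauchy.uniformStrip_explicit` at
`a₋ = a₊ = 1`, `m²₊ = 0`). -/
def kapE (d : ℕ) : ℝ := min (rOf d) (1 * (4 / Real.pi ^ 2) ^ d / 2 / (LambdaOf d 1 1 0 * d + 1))

/-- [folklore] the explicit half-width of the zero-free strip of the hard denominator `E n 1 0 − Δ^ξ` (`CoarseCovarianceSymbol.F_lower`). -/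
def kapF (d : ℕ) : ℝ := min (rOf d) ((4 / Real.pi ^ 2) ^ d / 2 / ((boundM d 1 0 + 16 * d) / rOf d * d + 1))

/-- [folklore] **THE COMMON EXPLICIT STRIP HALF-WIDTH** of the hard minimiser column: `kapH = min kapE kapF` (a function of `d` alone). -/
def kapH (d : ℕ) : ℝ := min (kapE d) (kapF d)

/-- [folklore] the common explicit lower bound `½(4∕π²)^d` of both denominators on `Strip d (kapH d)`. -/
def cH (d : ℕ) : ℝ := (4 / Real.pi ^ 2) ^ d / 2

/-- [folklore] `cH > 0`. -/
theorem cH_pos (d : ℕ) : 0 < cH d := by unfold cH; positivity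

/-- [folklore] `kapE > 0` and the lower bound of `E n 1 0` on `Strip d (kapE d)`, every `n ≥ 1`. -/
theorem E_lower_kapE (d : ℕ) : 0 < kapE d ∧ ∀ (n : ℕ) [NeZero n], ∀ p ∈ Strip d (kapE d), cH d ≤ ‖E n 1 0 p‖ := by
  obtain ⟨hκ, h⟩ := uniformStrip_explicit d 1 1 0 one_pos
  refine ⟨hκ, fun n _ p hp => ?_⟩
  have h1 := h n 1 0 le_rfl le_rfl le_rfl le_rfl p hp
  unfold cH
  simpa using h1

/-- [folklore] `kapF > 0` and the lower bound of `E n 1 0 − Δ^ξ` on `Strip d (kapF d)`, every `n ≥ 1`. -/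
theorem F_lower_kapF (d : ℕ) : 0 < kapF d ∧ ∀ (n : ℕ) [NeZero n], ∀ p ∈ Strip d (kapF d), cH d ≤ ‖E n 1 0 p - DeltaXi n 0 p‖ :=
  CoarseCovarianceSymbol.F_lower d

/-- [folklore] `kapH > 0`. -/
theorem kapH_pos (d : ℕ) : 0 < kapH d := lt_min (E_lower_kapE d).1 (F_lower_kapF d).1

/-- [folklore] `kapH ≤ rOf`. -/
theorem kapH_le_rOf (d : ℕ) : kapH d ≤ rOf d := (min_le_left _ _).trans (min_le_left _ _)

/-- [folklore] **`cH ≤ |E n 1 0 p|` on `Strip d (kapH d)`**, every `n ≥ 1`. -/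
theorem E_lower_kapH (n : ℕ) [NeZero n] : ∀ p ∈ Strip d (kapH d), cH d ≤ ‖E n 1 0 p‖ := fun p hp =>
  (E_lower_kapE d).2 n p (strip_mono (min_le_left _ _) hp)

/-- [folklore] **`cH ≤ |E n 1 0 p − Δ^ξ_n(p)|` on `Strip d (kapH d)`**, every `n ≥ 1`. -/
theorem F_lower_kapH (n : ℕ) [NeZero n] : ∀ p ∈ Strip d (kapH d), cH d ≤ ‖E n 1 0 p - DeltaXi n 0 p‖ := fun p hp =>
  (F_lower_kapF d).2 n p (strip_mono (min_le_right _ _) hp)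

/-- [folklore] the explicit `n`-uniform bound of the hard column on the strip: `MH d = boundG d (cH d) 0 · (1 + 16d∕cH d)`. -/
def MH (d : ℕ) : ℝ := boundG d (cH d) 0 * (1 + 16 * (d : ℝ) / cH d)

/-- [folklore] `MH ≥ 0`. -/
theorem MH_nonneg (d : ℕ) : 0 ≤ MH d := by
  have h1 := boundG_nonneg d (cH_pos d) le_rfl
  have h2 := cH_pos d
  unfold MH; positivity

/-- [folklore] **EXPLICIT STRIP REGULARITY OF THE HARD MINIMISER COLUMN**: `StripRegular (Hm n τ) (kapH (d+1)) (MH (d+1))` for EVERY `n ≥ 1`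
and every fine offset `τ` — constants functions of `d` alone. -/
theorem stripRegular_Hm_explicit (n : ℕ) [NeZero n] (τ : Fin (d + 1) → Fin n) :
    StripRegular (d := d) (Hm n τ) (kapH (d + 1)) (MH (d + 1)) := by
  have h := stripRegular_Hm n τ (kapH_pos (d + 1)).le (kapH_le_rOf (d + 1)) (cH_pos (d + 1)) (cH_pos (d + 1))
    (E_lower_kapH n) (F_lower_kapH n)
  unfold MH
  exact_mod_cast h

/-- [folklore] explicit strip regularity of the sub-cell average of the finer hard column. -/
theorem stripRegular_avgHm_explicit (n L : ℕ) [NeZero n] [NeZero L] (τ : Fin (d + 1) → Fin n) :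
    StripRegular (d := d) (avgHm n L τ) (kapH (d + 1))
      ((‖((L : ℂ) ^ (d + 1))⁻¹‖ * ∑ _ρ : Fin (d + 1) → Fin L, boundG (d + 1) (cH (d + 1)) 0) * (1 + 16 * (d + 1) / cH (d + 1))) :=
  stripRegular_avgHm n L τ (kapH_pos (d + 1)).le (kapH_le_rOf (d + 1)) (cH_pos (d + 1)) (cH_pos (d + 1))
    (E_lower_kapH (n * L)) (F_lower_kapH (n * L))

/-- [folklore] **EXPLICIT STRIP REGULARITY OF THE DIFFERENCE MULTIPLIER WITH THE RATE**: `StripRegular (DmultH n L τ) (kapH (d+1)) (CH(n)∕n²)`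
with `CH n (d+1) L (cH (d+1)) (cH (d+1))`. -/
theorem stripRegular_DmultH_explicit (n L : ℕ) [NeZero n] [NeZero L] (τ : Fin (d + 1) → Fin n) :
    StripRegular (d := d) (DmultH n L τ) (kapH (d + 1)) (CH n (d + 1) L (cH (d + 1)) (cH (d + 1)) / (n : ℝ) ^ 2) :=
  stripRegular_DmultH n L τ (kapH_pos (d + 1)).le (kapH_le_rOf (d + 1)) (cH_pos (d + 1)) (cH_pos (d + 1))
    (E_lower_kapH n) (E_lower_kapH (n * L)) (F_lower_kapH n) (F_lower_kapH (n * L))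

/-! ## §2 The torus twins, uniformly in the period vector -/

/-- [folklore] **`k`-UNIFORM, VOLUME-UNIFORM EXPONENTIAL DECAY OF THE TORUS KERNELS OF THE HARD MINIMISER COLUMN** (B5 (1.126) on the torus by the
Poisson-periodisation engine): for every period vector `N` (all `N_μ ≥ 1`), every `n ≥ 1`, `τ`, `x ∈ ℤ^{d+1}`:
`‖torusKernel (descendC (Hm n τ) …) N x‖ ≤ MH(d+1)·periodConst(kapH(d+1), d)·e^{−(kapH(d+1)∕(d+1))·|x|_{T,∞}}`. -/
theorem torusKernel_Hm_decay (n : ℕ) [NeZero n] (τ : Fin (d + 1) → Fin n) {N : Fin (d + 1) → ℕ} (hN : ∀ i, 1 ≤ N i)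
    (x : Fin (d + 1) → ℤ) :
    ‖torusKernel (descendC (Hm n τ) (stripRegular_Hm_explicit n τ) (kapH_pos (d + 1)).le) N x‖
      ≤ MH (d + 1) * periodConst (kapH (d + 1)) d * Real.exp (-(kapH (d + 1) / (d + 1) * torusSupNorm N x)) :=
  torusKernel_descend_decay_torusMetric _ (kapH_pos (d + 1)) hN x

/-- [folklore] LINEARITY (difference): the difference of the torus kernels of two strip-regular multipliers is the torus kernel of their difference
(the torus kernel is a finite sum of grid samples; re-proved here to keep the imports light — cf. `T4GaugeActionRateStrip.torusKernel_descendC_sub`). -/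
theorem torusKernel_descendC_sub' {G₁ G₂ D : (Fin (d + 1) → ℂ) → ℂ} {κ M₁ M₂ M₃ : ℝ}
    (h₁ : StripRegular G₁ κ M₁) (h₂ : StripRegular G₂ κ M₂) (h₃ : StripRegular D κ M₃) (hD : ∀ p, D p = G₂ p - G₁ p)
    (hκ : 0 ≤ κ) (N : Fin (d + 1) → ℕ) (x : Fin (d + 1) → ℤ) :
    torusKernel (descendC G₂ h₂ hκ) N x - torusKernel (descendC G₁ h₁ hκ) N x = torusKernel (descendC D h₃ hκ) N x := by
  unfold MultiPeriod.torusKernel MultiPeriod.torusSum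
  rw [← mul_sub, ← Finset.sum_sub_distrib]
  congr 1
  refine Finset.sum_congr rfl fun k _ => ?_
  rw [descendC_apply, descendC_apply, descendC_apply]
  unfold descend
  rw [hD]
  ring

/-- [folklore] LINEARITY (scaled finite sum): the torus kernel of the sub-cell-averaged multiplier is the sub-cell average of the torus kernels. -/
theorem torusKernel_descendC_avg (n L : ℕ) [NeZero n] [NeZero L] (τ : Fin (d + 1) → Fin n) (N : Fin (d + 1) → ℕ)
    (x : Fin (d + 1) → ℤ) :
    torusKernel (descendC (avgHm n L τ) (stripRegular_avgHm_explicit n L τ) (kapH_pos (d + 1)).le) N x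
      = ((L : ℂ) ^ (d + 1))⁻¹ * ∑ ρ : Fin (d + 1) → Fin L,
          torusKernel (descendC (Hm (n * L) (Tsub n L τ ρ)) (stripRegular_Hm_explicit (n * L) (Tsub n L τ ρ))
            (kapH_pos (d + 1)).le) N x := by
  unfold MultiPeriod.torusKernel MultiPeriod.torusSum
  simp only [descendC_apply]
  unfold descend avgHm
  simp only [Finset.mul_sum, Finset.sum_mul]
  rw [Finset.sum_comm]
  refine Finset.sum_congr rfl fun ρ _ => Finset.sum_congr rfl fun k _ => ?_
  ring

/-- [folklore] **THE TORUS END — THE SUB-AVERAGED ONE-STEP RATE OF THE HARD MINIMISER ON EVERY TORUS, UNIFORMLY IN THE VOLUME.**  For every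
period vector `N` (all `N_μ ≥ 1`), every `L ≥ 1`, `n ≥ 1`, `τ ∈ (Fin n)^{d+1}` and every lattice vector `x`:
`‖(L^{d+1})⁻¹ Σ_ρ torusKernel (descendC (Hm (n·L) (Tsub τ ρ)) …) N x − torusKernel (descendC (Hm n τ) …) N x‖
 ≤ CH(n, d+1, L, cH, cH)∕n² · periodConst(kapH(d+1), d) · e^{−(kapH(d+1)∕(d+1))·|x|_{T,∞}}` — the torus twin of FILE B's END (`n = L^k`:
rate `θ = L⁻²` up to `k^{d+1}`; block currencies remove the logarithm as in FILE C), with constants depending on `d`, `L` only. -/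
theorem subavg_minimiser_rate_torus (n L : ℕ) [NeZero n] [NeZero L] (τ : Fin (d + 1) → Fin n) {N : Fin (d + 1) → ℕ}
    (hN : ∀ i, 1 ≤ N i) (x : Fin (d + 1) → ℤ) :
    ‖((L : ℂ) ^ (d + 1))⁻¹ * ∑ ρ : Fin (d + 1) → Fin L,
          torusKernel (descendC (Hm (n * L) (Tsub n L τ ρ)) (stripRegular_Hm_explicit (n * L) (Tsub n L τ ρ))
            (kapH_pos (d + 1)).le) N x
        - torusKernel (descendC (Hm n τ) (stripRegular_Hm_explicit n τ) (kapH_pos (d + 1)).le) N x‖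
      ≤ CH n (d + 1) L (cH (d + 1)) (cH (d + 1)) / (n : ℝ) ^ 2 * periodConst (kapH (d + 1)) d
          * Real.exp (-(kapH (d + 1) / (d + 1) * torusSupNorm N x)) := by
  rw [← torusKernel_descendC_avg n L τ N x,
    torusKernel_descendC_sub' (stripRegular_Hm_explicit n τ) (stripRegular_avgHm_explicit n L τ)
      (stripRegular_DmultH_explicit n L τ) (fun p => rfl) (kapH_pos (d + 1)).le N x]
  exact torusKernel_descend_decay_torusMetric _ (kapH_pos (d + 1)) hN x

end Summit.QuantumFields.BalabanUV.Beta.GAN24.SubAveragingMinimiserTorus
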